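import Mathlib
import Literature.Probability.RandomPlanarGeometry.HexSAW
import Literature.Probability.LatticeModels.AnchoredClusterExpansion
import Summits.CriticalPhenomena.SAWScalingLimit.Theorems.SAWMassiveIsingTiltCriticalCurveContinuityEvenSubgraphSumSplit
import Summits.CriticalPhenomena.SAWScalingLimit.Theorems.SAWMassiveIsingTiltCriticalCurveContinuityDifferentiableZloop

/-!
# The loop gas is a subset-polymer gas of connected even subgraphs (route `SAWMassiveIsingTilt`)

Route `SAWMassiveIsingTilt` of `CriticalPhenomena/SAWScalingLimit`; lead prover (c3) of the line
`registered` of the crux `CriticalCurveContinuity` (stmt-CriticalPhenomena-7686), cycle 3, sub-goal S-C.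

For a finite set `EH` of edges, a finite vertex set `T` and a complex edge weight `z`, the
even-subgraph generating function `Σ_{E ⊆ EH, supp E ⊆ T, all degrees even} z^{|E|}` (for
`EH = E(Ω_δ)` this is the route's loop-`O(1)` partition function `Zloop(Ω_δ, T; z)`) equals the
partition function (`Literature.Probability.LatticeModels.polymerPartitionFunction`) of the
SUBSET-POLYMER gas (`polyInc`: polymers are finite vertex sets, incompatible iff equal or
intersecting) on the volume `T.powerset` with activity
`ρ(A) = Σ_{E ⊆ EH : supp E = A ≠ ∅, E even, E connected on A} z^{|E|}`
(`evenSubgraph_sum_eq_polymerPartitionFunction`). This puts the bath of the route into the tree's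
PROVED Kotecký–Preiss cluster expansion (`ClusterExpansion`, `ClusterExpansionKPBound`,
`AnchoredClusterExpansion`).

Proof: strong induction on `T`. At a vertex `v ∈ T`, the even subgraphs split by the landed
component extraction `evenSubgraph_sum_split` (p153664) into those avoiding `v` (supported in
`T.erase v`) and the pairs (connected even component through `v` with support `A ∋ v`, even
subgraph supported in `T ∖ A`); the polymer side splits the same way by deleting the clique of
polymers containing `v` (`polymerPartitionFunction_eq_sdiff_add_sum`).
-/

noncomputable section

open Finset
open Literature.Probability Literature.Probability.LatticeModels
  Literature.Probability.RandomPlanarGeometry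
open scoped Classical

namespace Summit.CriticalPhenomena.SAWScalingLimit.Theorems.SAWMassiveIsingTilt

/-- An edge set with empty support is empty. -/
theorem eq_empty_of_biUnion_toFinset_subset_empty {α : Type*} [DecidableEq α] {E : Finset (Sym2 α)}
    (h : E.biUnion Sym2.toFinset ⊆ ∅) : E = ∅ := by
  rw [Finset.eq_empty_iff_forall_notMem]
  intro e he
  have hne := Sym2.toFinset_ne_empty e
  rw [← Finset.nonempty_iff_ne_empty] at hne
  obtain ⟨u, hu⟩ := hne
  exact Finset.notMem_empty u (h (Finset.mem_biUnion.2 ⟨e, he, hu⟩))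

/-- The even subgraphs supported in the empty vertex set: only the empty one. -/
theorem filter_evenSubgraph_empty (EH : Finset (Sym2 HexVertex)) :
    (EH.powerset.filter fun E => E.biUnion Sym2.toFinset ⊆ (∅ : Finset HexVertex) ∧
      ∀ u : HexVertex, Even (E.filter (fun e => u ∈ e)).card) = {∅} := by
  ext E
  simp only [Finset.mem_filter, Finset.mem_powerset, Finset.mem_singleton]
  constructor
  · rintro ⟨-, h, -⟩
    exact eq_empty_of_biUnion_toFinset_subset_empty h
  · rintro rfl
    exact ⟨Finset.empty_subset _, by simp, fun u => by simp⟩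

/-- The sets of `T` not containing `v` are the subsets of `T.erase v`. -/
theorem powerset_sdiff_filter_mem (T : Finset HexVertex) (v : HexVertex) :
    T.powerset \ T.powerset.filter (fun A => v ∈ A) = (T.erase v).powerset := by
  ext B
  simp only [Finset.mem_sdiff, Finset.mem_powerset, Finset.mem_filter, Finset.subset_erase]
  tauto

/-- For a polymer `A ∋ v` of `T`, the polymers of `T.erase v` compatible with `A` are the subsets
of `T ∖ A`. -/
theorem filter_not_polyInc_eq_powerset_sdiff {T A : Finset HexVertex} {v : HexVertex}
    (hvA : v ∈ A) :
    ((T.erase v).powerset.filter fun B => ¬ polyInc A B) = (T \ A).powerset := by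
  ext B
  simp only [Finset.mem_filter, Finset.mem_powerset, polyInc, not_or, Finset.not_nonempty_iff_eq_empty,
    Finset.subset_sdiff, Finset.subset_erase]
  constructor
  · rintro ⟨⟨hBT, -⟩, -, hAB⟩
    exact ⟨hBT, Finset.disjoint_iff_inter_eq_empty.2 (by rwa [Finset.inter_comm])⟩
  · rintro ⟨hBT, hdisj⟩
    have hvB : v ∉ B := fun h => Finset.disjoint_left.1 hdisj h hvA
    refine ⟨⟨hBT, hvB⟩, fun h => hvB (h ▸ hvA), ?_⟩
    rw [Finset.inter_comm]
    exact Finset.disjoint_iff_inter_eq_empty.1 hdisj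


/-- Inner sum of the `v`-part: the remainder `E₂` is disjoint from the component `E₁`, so the
weight factorises, `z^{|E₁ ∪ E₂|} = z^{|E₁|} z^{|E₂|}`. -/
theorem sum_pow_card_union_eq_mul (EH : Finset (Sym2 HexVertex)) (T : Finset HexVertex)
    (E₁ : Finset (Sym2 HexVertex)) (z : ℂ) :
    (∑ E₂ ∈ EH.powerset with (E₂.biUnion Sym2.toFinset ⊆ T \ E₁.biUnion Sym2.toFinset ∧
        ∀ u : HexVertex, Even (E₂.filter (fun e => u ∈ e)).card), z ^ (E₁ ∪ E₂).card) =
      z ^ E₁.card *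
        ∑ E₂ ∈ EH.powerset with (E₂.biUnion Sym2.toFinset ⊆ T \ E₁.biUnion Sym2.toFinset ∧
          ∀ u : HexVertex, Even (E₂.filter (fun e => u ∈ e)).card), z ^ E₂.card := by
  rw [Finset.mul_sum]
  refine Finset.sum_congr rfl fun E₂ hE₂ => ?_
  have hsub := (Finset.mem_filter.1 hE₂).2.1
  have hdisj : Disjoint E₁ E₂ := evenSplit_disjoint fun u hu hu1 =>
    (Finset.mem_sdiff.1 (hsub hu)).2 hu1
  rw [Finset.card_union_of_disjoint hdisj, pow_add]

/-- The connected even components through `v` with a prescribed support `A ∋ v`, `A ⊆ T`, are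
exactly the fibre of the polymer activity at `A`. -/
theorem filter_component_supp_eq (EH : Finset (Sym2 HexVertex)) {T A : Finset HexVertex}
    {v : HexVertex} (hAT : A ⊆ T) (hvA : v ∈ A) :
    ((EH.powerset.filter fun E₁ => E₁.biUnion Sym2.toFinset ⊆ T ∧
        (∀ u : HexVertex, Even (E₁.filter (fun e => u ∈ e)).card) ∧
        v ∈ E₁.biUnion Sym2.toFinset ∧
        ∀ u ∈ E₁.biUnion Sym2.toFinset, ∀ w ∈ E₁.biUnion Sym2.toFinset,
          (SimpleGraph.fromEdgeSet ((E₁ : Finset (Sym2 HexVertex)) : Set (Sym2 HexVertex))).Reachable u w).filter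
      fun E₁ => E₁.biUnion Sym2.toFinset = A) =
    EH.powerset.filter fun E => E.biUnion Sym2.toFinset = A ∧ A.Nonempty ∧
      (∀ u : HexVertex, Even (E.filter (fun e => u ∈ e)).card) ∧
      ∀ u ∈ A, ∀ w ∈ A,
        (SimpleGraph.fromEdgeSet ((E : Finset (Sym2 HexVertex)) : Set (Sym2 HexVertex))).Reachable u w := by
  ext E
  simp only [Finset.mem_filter, Finset.mem_powerset]
  constructor
  · rintro ⟨⟨hE, -, heven, -, hconn⟩, hA⟩
    subst hA
    exact ⟨hE, rfl, ⟨v, hvA⟩, heven, hconn⟩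
  · rintro ⟨hE, hA, -, heven, hconn⟩
    subst hA
    exact ⟨⟨hE, hAT, heven, hvA, hconn⟩, rfl⟩

/-- **Sub-goal S-C of the line (cycle 3): the even-subgraph generating function is the
subset-polymer gas of connected even subgraphs.** For a finite edge set `EH`, a finite vertex set
`T` and `z ∈ ℂ`: `Σ_{E ⊆ EH, supp E ⊆ T, E even} z^{|E|}` equals the `polyInc` partition function on
`T.powerset` with activity `ρ(A) = Σ_{E ⊆ EH : supp E = A ≠ ∅, E even and connected on A} z^{|E|}`. -/
theorem evenSubgraph_sum_eq_polymerPartitionFunction :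
    ∀ (EH : Finset (Sym2 HexVertex)) (T : Finset HexVertex) (z : ℂ),
    (∑ E ∈ EH.powerset with (E.biUnion Sym2.toFinset ⊆ T ∧
        ∀ u : HexVertex, Even (E.filter (fun e => u ∈ e)).card), z ^ E.card) =
      polymerPartitionFunction polyInc
        (fun A : Finset HexVertex => ∑ E ∈ EH.powerset with (E.biUnion Sym2.toFinset = A ∧
            A.Nonempty ∧ (∀ u : HexVertex, Even (E.filter (fun e => u ∈ e)).card) ∧
            ∀ u ∈ A, ∀ w ∈ A,
              (SimpleGraph.fromEdgeSet ((E : Finset (Sym2 HexVertex)) : Set (Sym2 HexVertex))).Reachable u w),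
          z ^ E.card)
        T.powerset := by
  intro EH T z
  induction T using Finset.strongInduction with
  | H T ih =>
    rcases T.eq_empty_or_nonempty with rfl | ⟨v, hvT⟩
    · -- base case: only the empty subgraph; the only polymer `∅` has activity `0`
      rw [filter_evenSubgraph_empty, Finset.sum_singleton, Finset.card_empty, pow_zero,
        Finset.powerset_empty, ← insert_empty_eq,
        polymerPartitionFunction_insert inc_symm_of_symm _ (Finset.notMem_empty _),
        polymerPartitionFunction_empty]
      have h0 : (∑ E ∈ EH.powerset with (E.biUnion Sym2.toFinset = (∅ : Finset HexVertex) ∧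
            (∅ : Finset HexVertex).Nonempty ∧ (∀ u : HexVertex, Even (E.filter (fun e => u ∈ e)).card) ∧
            ∀ u ∈ (∅ : Finset HexVertex), ∀ w ∈ (∅ : Finset HexVertex),
              (SimpleGraph.fromEdgeSet ((E : Finset (Sym2 HexVertex)) : Set (Sym2 HexVertex))).Reachable u w),
          z ^ E.card) = 0 := by
        refine Finset.sum_eq_zero fun E hE => ?_
        exact absurd (Finset.mem_filter.1 hE).2.2.1 Finset.not_nonempty_empty
      rw [h0, zero_mul, add_zero]
    · -- step at `v ∈ T`
      rw [evenSubgraph_sum_split EH T v (fun E => z ^ E.card)]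
      have hD : T.powerset.filter (fun A => v ∈ A) ⊆ T.powerset := Finset.filter_subset _ _
      have hclique : ∀ A ∈ T.powerset.filter (fun A => v ∈ A),
          ∀ A' ∈ T.powerset.filter (fun A => v ∈ A), A ≠ A' → polyInc A A' :=
        fun A hA A' hA' _ => Or.inr ⟨v, Finset.mem_inter.2
          ⟨(Finset.mem_filter.1 hA).2, (Finset.mem_filter.1 hA').2⟩⟩
      rw [polymerPartitionFunction_eq_sdiff_add_sum _ hD hclique, powerset_sdiff_filter_mem]
      congr 1
      · exact ih _ (Finset.erase_ssubset hvT)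
      · -- the `v`-part: component through `v` with support `A` ↔ polymer `A ∋ v`
        rw [Finset.sum_congr rfl fun E₁ _ => sum_pow_card_union_eq_mul EH T E₁ z]
        symm
        rw [← Finset.sum_fiberwise_of_maps_to (s := EH.powerset.filter fun E₁ =>
            E₁.biUnion Sym2.toFinset ⊆ T ∧
            (∀ u : HexVertex, Even (E₁.filter (fun e => u ∈ e)).card) ∧
            v ∈ E₁.biUnion Sym2.toFinset ∧
            ∀ u ∈ E₁.biUnion Sym2.toFinset, ∀ w ∈ E₁.biUnion Sym2.toFinset,
              (SimpleGraph.fromEdgeSet ((E₁ : Finset (Sym2 HexVertex)) : Set (Sym2 HexVertex))).Reachable u w)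
          (t := T.powerset.filter fun A => v ∈ A) (g := fun E₁ => E₁.biUnion Sym2.toFinset)
          (fun E₁ hE₁ => Finset.mem_filter.2 ⟨Finset.mem_powerset.2 (Finset.mem_filter.1 hE₁).2.1,
            (Finset.mem_filter.1 hE₁).2.2.2.1⟩)]
        refine Finset.sum_congr rfl fun A hA => ?_
        have hAT : A ⊆ T := Finset.mem_powerset.1 (Finset.mem_filter.1 hA).1
        have hvA : v ∈ A := (Finset.mem_filter.1 hA).2
        have hssub : T \ A ⊂ T := Finset.sdiff_ssubset hAT ⟨v, hvA⟩
        rw [filter_not_polyInc_eq_powerset_sdiff hvA, ← ih _ hssub, ← filter_component_supp_eq EH hAT hvA,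
          Finset.sum_mul]
        refine Finset.sum_congr rfl fun E₁ hE₁ => ?_
        rw [(Finset.mem_filter.1 hE₁).2]

/-! ### The route's `Zloop` as a polymer partition function -/

/-- For a bounded domain and a nonzero mesh, the even subgraphs of `Ω_δ` inside `S` (the index
set of `Zloop(Ω_δ, S; ·)`) are the subsets of the edge set `E(Ω_δ)` supported in the vertices of
`E(Ω_δ)` lying in `S`, with all degrees even. -/
theorem toFinset_evenSubgraph_eq_filter {Ω : Set ℂ} (hΩ : Bornology.IsBounded Ω) {δ : ℝ} (hδ : δ ≠ 0)
    (S : Set HexVertex) :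
    (finite_setOf_evenSubgraph hΩ hδ S).toFinset =
      (finite_edgeSet_hexDomainGraph hΩ hδ).toFinset.powerset.filter fun E =>
        E.biUnion Sym2.toFinset ⊆
            ((finite_edgeSet_hexDomainGraph hΩ hδ).toFinset.biUnion Sym2.toFinset).filter
              (fun v => v ∈ S) ∧
          ∀ u : HexVertex, Even (E.filter (fun e => u ∈ e)).card := by
  ext E
  simp only [Set.Finite.mem_toFinset, Set.mem_setOf_eq, Finset.mem_filter, Finset.mem_powerset,
    Finset.subset_iff, Finset.mem_biUnion, Sym2.mem_toFinset]
  constructor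
  · rintro ⟨h, heven⟩
    exact ⟨fun e he => (h e he).1, fun u ⟨e, he, hue⟩ => ⟨⟨e, (h e he).1, hue⟩, (h e he).2 u hue⟩,
      heven⟩
  · rintro ⟨hsub, hsupp, heven⟩
    exact ⟨fun e he => ⟨hsub he, fun u hue => (hsupp ⟨e, he, hue⟩).2⟩, heven⟩

/-- **The route's loop-gas partition function is a subset-polymer partition function**: for a
bounded domain `Ω`, a nonzero mesh `δ`, a vertex set `S` and `y ∈ ℝ`,
`Zloop(Ω_δ, S; y) = Ξ_{polyInc}(ρ; 𝒫(T_S))`, where `T_S` is the set of vertices of `E(Ω_δ)` in `S` and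
`ρ(A) = Σ_{E ⊆ E(Ω_δ) : supp E = A ≠ ∅, E even and connected on A} y^{|E|}` (as a complex number). -/
theorem zloop_eq_polymerPartitionFunction {Ω : Set ℂ} (hΩ : Bornology.IsBounded Ω) {δ : ℝ} (hδ : δ ≠ 0)
    (S : Set HexVertex) (y : ℝ) :
    ((Zloop (SAW.hexDomainGraph Ω δ) S y : ℝ) : ℂ) =
      polymerPartitionFunction polyInc
        (fun A : Finset HexVertex => ∑ E ∈ (finite_edgeSet_hexDomainGraph hΩ hδ).toFinset.powerset with
            (E.biUnion Sym2.toFinset = A ∧ A.Nonempty ∧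
              (∀ u : HexVertex, Even (E.filter (fun e => u ∈ e)).card) ∧
              ∀ u ∈ A, ∀ w ∈ A,
                (SimpleGraph.fromEdgeSet ((E : Finset (Sym2 HexVertex)) : Set (Sym2 HexVertex))).Reachable u w),
          (y : ℂ) ^ E.card)
        (((finite_edgeSet_hexDomainGraph hΩ hδ).toFinset.biUnion Sym2.toFinset).filter
          (fun v => v ∈ S)).powerset := by
  rw [zloop_eq_finset_sum hΩ hδ S y, Complex.ofReal_sum]
  simp only [Complex.ofReal_pow]
  rw [toFinset_evenSubgraph_eq_filter hΩ hδ S]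
  exact evenSubgraph_sum_eq_polymerPartitionFunction _ _ _

end Summit.CriticalPhenomena.SAWScalingLimit.Theorems.SAWMassiveIsingTilt

end
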